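import Summits.BirchSwinnertonDyer.Rank1Residual.X12.CMSevenAwayFromSeven
import Summits.BirchSwinnertonDyer.Rank1Residual.X12.CubeSumSylvesterOddPart
import Literature.NumberTheory.EllipticCurves.Rank1Residual.Typed.X12
import HarnessLib

/-!
# CM cell (`bsd-cm`) — the three RUNG LEAVES K7r / K7t / K8 as CLOSED typed targets (D-0059 / D-0061)

Board rulings D-0059 (every ladder rung with a concrete mathematical target becomes a ledger ROUTE)
and D-0061 (a route may close a registered RUNG LEAF of the summit sub-problem via
`--closes-target <leaf FQN>`; no per-rung sub-problem is minted): this file states the three rung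
targets of the CM cell as CLOSED `Prop`s over tree declarations — `@[conjecture] def`, no section
variables (`#check @CMRamifiedSeven : Prop`), NOTHING ASSERTED, no named fact baked in (published
inputs and every PRE / unrefereed input stay route ITEMS). The words are the ladder's
(`LADDER-BSD.md` K7r, K7t, K8):

* `CMRamifiedSeven` (K7r) — full BSD, prime by prime in Miller's sense `BSDp W p`, for every curve of
  the class 𝒞₇ (`X12.ClassCSeven`: CM by `ℤ[(1+√−7)/2]`, analytic rank one, additive at `7`, no CM
  ramified prime other than `7` is bad); by `X12.ClassCSeven.forall_bsdp_iff_bsdp_seven` this is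
  `BSD(E, 7)` on 𝒞₇ granted the published facts away from `7`.
* `CMAtTwo` (K7t) — `BSD(E_p, 2)` for the Sylvester curves `E_p : x³ + y³ = p`, `p ≡ 4, 7 (mod 9)`,
  `3 ∤ #{cube roots of 3 mod p}`-condition of Hu–Shu–Yin (the class 𝒞_HSY, analytic rank one by
  Hu–Shu–Yin 2019 Thm 1.4), on every globally minimal model; with `X12.Sylvester.forall_bsdp_iff_bsdp_two`
  this is the last prime of full BSD on 𝒞_HSY.
* `CMInertBad` (K8) — the typed missing input `Typed.X12.MissingInputAt W p` at every pair `(E, p)`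
  with `E` CM of analytic rank one, `p` odd, inert in the CM field and BAD (the O10 class), i.e. the
  `∀`-closure of the cell's O10 target.

[cite: Miller2011LMS, §1 and Def. 1.1] [cite: HuShuYin2019, Thm. 1.4] [cite: LiLiuTian2024, Thm. 1.1 (i) and p. 2 (shape only; nothing asserted)]
-/

noncomputable section

open scoped Classical

open WeierstrassCurve Literature.NumberTheory.EllipticCurves
  Literature.NumberTheory.EllipticCurves.Rank1Residual
  Literature.NumberTheory.EllipticCurves.HuShuYin2019

namespace Summit.BirchSwinnertonDyer.Rank1Residual.X12

/-- **RUNG LEAF K7r (`CMRamifiedSeven`; OPEN, nothing asserted).** Full BSD, prime by prime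
(`BSDp W p` for every prime `p`, Miller 2011 Def. 1.1), for every globally minimal `W` of the class
𝒞₇ (`ClassCSeven W`). Equivalent, granted the published facts away from `7`, to `BSD(E, 7)` on 𝒞₇
(`ClassCSeven.forall_bsdp_iff_bsdp_seven`); no theorem in print decides it (BKNO 2026 give no
formula at the ramified prime). [cite: Miller2011LMS, §1 and Def. 1.1]
[cite: BurungaleKobayashiNakamuraOta2026, Thm. 7.2 and §1.4 (arXiv:2608.06879 pp. 8, 40) (claim; preprint; shape only)] -/
@[conjecture] def CMRamifiedSeven : Prop :=
  ∀ (W : WeierstrassCurve ℚ) [W.IsElliptic] [W.IsGloballyMinimal],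
    ClassCSeven W → ∀ p : ℕ, p.Prime → BSDp W p

/-- **RUNG LEAF K7t (`CMAtTwo`; OPEN, nothing asserted).** `BSD(E_p, 2)` (Miller 2011 Def. 1.1 at
`p = 2`) for every globally minimal model `B` of the Sylvester curve `E_p : x³ + y³ = p`
(`cubeSumCurve p`) with `p ≡ 4, 7 (mod 9)` and `3` not a cube mod `p` — the class 𝒞_HSY of
Hu–Shu–Yin 2019 Thm 1.4 (analytic rank one). No theorem in print decides the `2`-part for these CM
curves (`2` inert in `ℚ(√−3)`). [cite: HuShuYin2019, Thm. 1.4] [cite: Miller2011LMS, §1 and Def. 1.1] -/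
@[conjecture] def CMAtTwo : Prop :=
  ∀ (p : ℕ), p.Prime → (p % 9 = 4 ∨ p % 9 = 7) → (¬ ∃ x : ZMod p, x ^ 3 = 3) →
    ∀ (B : WeierstrassCurve ℚ) [B.IsElliptic] [B.IsGloballyMinimal],
      (∃ C : WeierstrassCurve.VariableChange ℚ, C • B = cubeSumCurve (p : ℚ)) → BSDp B 2

/-- **RUNG LEAF K8 (`CMInertBad`; OPEN, nothing asserted).** The typed missing input
`Typed.X12.MissingInputAt W p` (`#Ш_an ∈ ℚ` with `ord_p #Ш_an = ord_p #Ш`, outside the odd split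
corner) at every pair `(E, p)`: `E` with CM, analytic rank one, `p ≠ 2` inert in the CM field and of
BAD reduction — the O10 class of the cell (Rubin 1991 needs `p` split, Kobayashi 2013 needs `p` good;
nothing in print at inert bad `p`). [cite: LiLiuTian2024, Thm. 1.1 (i) and p. 2 (shape only; nothing asserted)]
[cite: Miller2011LMS, §1 and Def. 1.1] -/
@[conjecture] def CMInertBad : Prop :=
  ∀ (W : WeierstrassCurve ℚ) [W.IsElliptic] [W.IsGloballyMinimal] (p : ℕ) [Fact p.Prime],
    W.HasCM → W.analyticRank = 1 → p ≠ 2 → CMInert W p → ¬ Good W p → Typed.X12.MissingInputAt W p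

end Summit.BirchSwinnertonDyer.Rank1Residual.X12

end
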